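import Summits.QuantumFields.YangMills.Theorems.ColdStartUniversalityFeynmanKacLezaudForm
import HarnessLib

/-!
# Route `ColdStartUniversality` (fixed-cut-off package, sampler statistics): the LEÓN–PERRON FORM BOUND — the quadratic form of the
# Feynman–Kac sandwich `g ↦ e^{sV/2} P(e^{sV/2} g)` of a positive reversible kernel with form-gap `1 − r` is at most `exp((1+r)s²b²/(2(1−r)))`

Helper file (seat `ym-line-csu-p1`, g37; `--supports stmt-QuantumFields-24809`).  ABSTRACT (no SZZ object), toolkit namespace
`…ColdStartUniversality.FeynmanKac`, companion of `…FeynmanKacLezaudForm`.  `lezaud_form_bound` expands in the tilt `ε` and is sharp only as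
`ε → 0` (continuous time).  For a FIXED sampling interval the sharp discrete-time bound (León–Perron 2004; Fan–Jiang–Sun 2021 for general
state spaces) comes from a rank-one secular equation and a two-point comparison, both elementary here:

* ★★ `form_le_of_secular` — if `m > r·w²` pointwise and `(1 − r) ∫ w²/(m − r w²) dμ ≤ 1` then `r∫w²g² + (1 − r)(∫wg)² ≤ m ∫g²` for all bounded
  measurable `g` (Cauchy–Schwarz with the weight `m − r w²`: the top eigenvalue of `r·w² + (1 − r)|w⟩⟨w|` through its secular equation);
* `moebius_chord_le` — the chord inequality for the convex Möbius map `x ↦ x/(m − rx)` on `[x₋, x₊]`, `m > r x₊` (explicit factorisation);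
* `integral_exp_mul_le_cosh` — HOEFFDING'S LEMMA, first half: `|V| ≤ b`, `∫V dμ = 0` ⇒ `∫ e^{sV} dμ ≤ cosh(sb)` (chord of `exp`);
* ★ `integral_moebius_exp_le_two_point` — hence `∫ e^{sV}/(m − re^{sV}) dμ ≤ ½[x₋/(m − rx₋) + x₊/(m − rx₊)]`, `x± = e^{±sb}`: the worst
  case is the symmetric two-point law (León–Perron's reduction to the two-state chain);
* ★ `two_point_secular_le_one` — with `κ = (1+r)/(1−r)` and `m = exp(κ(sb)²/2)`: `m > r·e^{sb}` and the two-point secular value is `≤ 1`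
  (`e^{κy} + re^{−κy} ≥ (1+r)e^{y} ≥ (1+r)cosh(sb)`, `y = (sb)²/2`, by two-point Jensen for `exp` and `cosh x ≤ e^{x²/2}`);
* ★★★ `hoeffding_form_bound` — for a probability measure `μ`, `V` measurable with `|V| ≤ b` (`b > 0`), `∫V dμ = 0`, `0 ≤ s`, `0 ≤ r < 1`, and
  EVERY bounded measurable `g`:  `r ∫ e^{sV} g² dμ + (1 − r)(∫ e^{sV/2} g dμ)² ≤ exp(((1+r)/(1−r))·(sb)²/2) · ∫ g² dμ`
  — the León–Perron / Fan–Jiang–Sun variance proxy `(1+r)/(1−r)·b²`, optimal for two-state chains.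

[cite: LeonPerron2004, Theorem 1] [cite: Lezaud2001, §4].  THEOREMS ONLY, no definition, no sorry.  HONEST FRAMING: abstract real / measure-theoretic
bookkeeping for the fixed-cut-off sampler package; nothing is uniform in any cut-off; no crux, rung or summit statement is proved; the
Yang–Mills mass gap is NOT proved.
-/

set_option autoImplicit false

noncomputable section

namespace Summit.QuantumFields.YangMills.Theorems.ColdStartUniversality.FeynmanKac

open MeasureTheory ProbabilityTheory Filter Set
open scoped BigOperators NNReal ENNReal

variable {X : Type*} [MeasurableSpace X]

/-! ## §1. The secular-equation form bound -/

/-- ★★ **Form bound from the secular equation (León–Perron reduction).**  Let `μ` be a finite measure, `w` measurable with `|w| ≤ W`,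
`0 ≤ r`, and `m` with `r·W² < m`.  If `(1 − r) ∫ w²/(m − r w²) dμ ≤ 1`, then for every bounded measurable `g`:
`r ∫ w² g² dμ + (1 − r)(∫ w g dμ)² ≤ m ∫ g² dμ`
(write `wg = (w/√(m − rw²))·(√(m − rw²) g)` and apply Cauchy–Schwarz). [cite: LeonPerron2004, Theorem 1 (proof, two-state reduction)] -/
theorem form_le_of_secular (μ : Measure X) [IsFiniteMeasure μ] {w : X → ℝ} (hw : Measurable w) {W : ℝ} (hwW : ∀ x, |w x| ≤ W)
    {r m : ℝ} (hr : 0 ≤ r) (hm : r * W ^ 2 < m)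
    (hsec : (1 - r) * ∫ x, w x ^ 2 / (m - r * w x ^ 2) ∂μ ≤ 1)
    {g : X → ℝ} (hg : Measurable g) {C : ℝ} (hgC : ∀ x, |g x| ≤ C) :
    r * ∫ x, w x ^ 2 * g x ^ 2 ∂μ + (1 - r) * (∫ x, w x * g x ∂μ) ^ 2 ≤ m * ∫ x, g x ^ 2 ∂μ := by
  -- the weight `D = m − r w² ≥ m − r W² > 0`
  have hW2 : ∀ x, w x ^ 2 ≤ W ^ 2 := fun x => by
    have := pow_le_pow_left₀ (abs_nonneg _) (hwW x) 2; rwa [sq_abs] at this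
  have hDpos : ∀ x, 0 < m - r * w x ^ 2 := fun x => by nlinarith [hW2 x]
  have hD0 : 0 < m - r * W ^ 2 := by linarith
  have hDm : Measurable fun x => m - r * w x ^ 2 := measurable_const.sub ((hw.pow_const 2).const_mul r)
  have hDb : ∀ x, |m - r * w x ^ 2| ≤ m := fun x => by
    rw [abs_of_pos (hDpos x)]; nlinarith [sq_nonneg (w x)]
  -- Cauchy–Schwarz with `φ = w/√D`, `ψ = √D·g`
  have hsqm : Measurable fun x => Real.sqrt (m - r * w x ^ 2) := Real.continuous_sqrt.measurable.comp hDm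
  have hsqpos : ∀ x, 0 < Real.sqrt (m - r * w x ^ 2) := fun x => Real.sqrt_pos.2 (hDpos x)
  have hφm : Measurable fun x => w x / Real.sqrt (m - r * w x ^ 2) := hw.div hsqm
  have hφb : ∀ x, |w x / Real.sqrt (m - r * w x ^ 2)| ≤ W / Real.sqrt (m - r * W ^ 2) := fun x => by
    rw [abs_div, abs_of_pos (hsqpos x)]
    have h1 : Real.sqrt (m - r * W ^ 2) ≤ Real.sqrt (m - r * w x ^ 2) := Real.sqrt_le_sqrt (by nlinarith [hW2 x])
    have h0 : 0 < Real.sqrt (m - r * W ^ 2) := Real.sqrt_pos.2 hD0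
    calc |w x| / Real.sqrt (m - r * w x ^ 2) ≤ |w x| / Real.sqrt (m - r * W ^ 2) :=
          div_le_div_of_nonneg_left (abs_nonneg _) h0 h1
      _ ≤ W / Real.sqrt (m - r * W ^ 2) := div_le_div_of_nonneg_right (hwW x) h0.le
  have hψm : Measurable fun x => Real.sqrt (m - r * w x ^ 2) * g x := hsqm.mul hg
  have hψb : ∀ x, |Real.sqrt (m - r * w x ^ 2) * g x| ≤ Real.sqrt m * C := fun x => by
    rw [abs_mul, abs_of_pos (hsqpos x)]
    exact mul_le_mul (Real.sqrt_le_sqrt (by nlinarith [sq_nonneg (w x)])) (hgC x) (abs_nonneg _) (Real.sqrt_nonneg _)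
  have hCS := sq_integral_mul_le μ hφm hφb hψm hψb
  have e1 : ∫ x, (w x / Real.sqrt (m - r * w x ^ 2)) * (Real.sqrt (m - r * w x ^ 2) * g x) ∂μ = ∫ x, w x * g x ∂μ :=
    integral_congr_ae (ae_of_all _ fun x => by
      show (w x / Real.sqrt (m - r * w x ^ 2)) * (Real.sqrt (m - r * w x ^ 2) * g x) = w x * g x
      have hne : Real.sqrt (m - r * w x ^ 2) ≠ 0 := (hsqpos x).ne'
      rw [div_mul_eq_mul_div, mul_comm (Real.sqrt (m - r * w x ^ 2)) (g x), ← mul_assoc, mul_div_cancel_right₀ _ hne])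
  have e2 : ∫ x, (w x / Real.sqrt (m - r * w x ^ 2)) ^ 2 ∂μ = ∫ x, w x ^ 2 / (m - r * w x ^ 2) ∂μ :=
    integral_congr_ae (ae_of_all _ fun x => by
      show (w x / Real.sqrt (m - r * w x ^ 2)) ^ 2 = w x ^ 2 / (m - r * w x ^ 2)
      rw [div_pow, Real.sq_sqrt (hDpos x).le])
  have e3 : ∫ x, (Real.sqrt (m - r * w x ^ 2) * g x) ^ 2 ∂μ = m * ∫ x, g x ^ 2 ∂μ - r * ∫ x, w x ^ 2 * g x ^ 2 ∂μ := by
    have h1 : ∫ x, (Real.sqrt (m - r * w x ^ 2) * g x) ^ 2 ∂μ = ∫ x, (m * g x ^ 2 - r * (w x ^ 2 * g x ^ 2)) ∂μ :=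
      integral_congr_ae (ae_of_all _ fun x => by
        show (Real.sqrt (m - r * w x ^ 2) * g x) ^ 2 = m * g x ^ 2 - r * (w x ^ 2 * g x ^ 2)
        rw [mul_pow, Real.sq_sqrt (hDpos x).le]; ring)
    have ig2 : Integrable (fun x => g x ^ 2) μ :=
      integrable_of_measurable_of_abs_le μ (hg.pow_const 2) (B := C ^ 2) fun x => by
        rw [abs_pow]; exact pow_le_pow_left₀ (abs_nonneg _) (hgC x) 2
    have iwg : Integrable (fun x => w x ^ 2 * g x ^ 2) μ :=
      integrable_of_measurable_of_abs_le μ ((hw.pow_const 2).mul (hg.pow_const 2)) (B := W ^ 2 * C ^ 2) fun x => by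
        rw [abs_mul, abs_pow, abs_pow]
        exact mul_le_mul (pow_le_pow_left₀ (abs_nonneg _) (hwW x) 2) (pow_le_pow_left₀ (abs_nonneg _) (hgC x) 2) (by positivity)
          (by positivity)
    rw [h1, integral_sub (ig2.const_mul m) (iwg.const_mul r), integral_const_mul, integral_const_mul]
  rw [e1, e2, e3] at hCS
  -- `(∫wg)² ≤ (∫ w²/D)(m∫g² − r∫w²g²)` and `(1 − r)∫w²/D ≤ 1`
  have hpos : 0 ≤ m * ∫ x, g x ^ 2 ∂μ - r * ∫ x, w x ^ 2 * g x ^ 2 ∂μ := by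
    rw [← e3]; exact integral_nonneg fun x => sq_nonneg _
  have hI0 : 0 ≤ ∫ x, w x ^ 2 / (m - r * w x ^ 2) ∂μ := integral_nonneg fun x => div_nonneg (sq_nonneg _) (hDpos x).le
  by_cases hr1 : 1 - r ≤ 0
  · have h2 : (1 - r) * (∫ x, w x * g x ∂μ) ^ 2 ≤ 0 := mul_nonpos_of_nonpos_of_nonneg hr1 (sq_nonneg _)
    linarith
  · have hr1 : 0 < 1 - r := lt_of_not_ge hr1
    have h3 : (1 - r) * (∫ x, w x * g x ∂μ) ^ 2 ≤ ((1 - r) * ∫ x, w x ^ 2 / (m - r * w x ^ 2) ∂μ) *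
        (m * ∫ x, g x ^ 2 ∂μ - r * ∫ x, w x ^ 2 * g x ^ 2 ∂μ) := by
      rw [mul_assoc]; exact mul_le_mul_of_nonneg_left hCS hr1.le
    have h4 : ((1 - r) * ∫ x, w x ^ 2 / (m - r * w x ^ 2) ∂μ) * (m * ∫ x, g x ^ 2 ∂μ - r * ∫ x, w x ^ 2 * g x ^ 2 ∂μ) ≤
        1 * (m * ∫ x, g x ^ 2 ∂μ - r * ∫ x, w x ^ 2 * g x ^ 2 ∂μ) := mul_le_mul_of_nonneg_right hsec hpos
    linarith

/-! ## §2. The two-point comparison -/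

omit [MeasurableSpace X] in
/-- The chord inequality for the Möbius map `x ↦ x/(m − rx)` on `[x₋, x₊]` (`0 ≤ r`, `r x₊ < m`, `x₋ < x₊`): it lies below its chord,
`x/(m − rx) ≤ x₋/(m − rx₋) + (x₊/(m − rx₊) − x₋/(m − rx₋))·(x − x₋)/(x₊ − x₋)` — explicit factorisation of the difference. [folklore] -/
theorem moebius_chord_le {r m xl xu x : ℝ} (hr : 0 ≤ r) (hm : r * xu < m) (hlu : xl < xu) (hxl : xl ≤ x) (hxu : x ≤ xu) (hxl0 : 0 ≤ xl) :
    x / (m - r * x) ≤ xl / (m - r * xl) + (xu / (m - r * xu) - xl / (m - r * xl)) * ((x - xl) / (xu - xl)) := by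
  have hDu : 0 < m - r * xu := by linarith
  have hDx : 0 < m - r * x := by nlinarith
  have hDl : 0 < m - r * xl := by nlinarith
  have hgap : 0 < xu - xl := by linarith
  have hm0 : 0 ≤ m := by nlinarith
  have hne1 : m - r * xl ≠ 0 := hDl.ne'
  have hne2 : m - r * xu ≠ 0 := hDu.ne'
  have hne3 : m - r * x ≠ 0 := hDx.ne'
  have hne4 : xu - xl ≠ 0 := hgap.ne'
  -- Möbius differences: `φ(u) − φ(v) = m(u − v)/((m − ru)(m − rv))`
  have hsub1 : x / (m - r * x) - xl / (m - r * xl) = m * (x - xl) / ((m - r * x) * (m - r * xl)) := by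
    rw [div_sub_div _ _ hne3 hne1]; congr 1; ring
  have hsub2 : (xu / (m - r * xu) - xl / (m - r * xl)) * ((x - xl) / (xu - xl)) = m * (x - xl) / ((m - r * xu) * (m - r * xl)) := by
    rw [div_sub_div _ _ hne2 hne1, div_mul_div_comm]
    have e : (xu * (m - r * xl) - (m - r * xu) * xl) * (x - xl) = m * (x - xl) * (xu - xl) := by ring
    rw [e, mul_div_mul_right _ _ hne4]
  have key : m * (x - xl) / ((m - r * x) * (m - r * xl)) ≤ m * (x - xl) / ((m - r * xu) * (m - r * xl)) :=
    div_le_div_of_nonneg_left (mul_nonneg hm0 (by linarith)) (mul_pos hDu hDl) (mul_le_mul_of_nonneg_right (by nlinarith) hDl.le)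
  linarith [hsub1, hsub2, key]

/-- **Hoeffding's lemma, first half**: for a probability measure `μ`, `V` measurable with `|V| ≤ b` (`b > 0`) and `∫ V dμ = 0`, and any real
`s`:  `∫ e^{sV} dμ ≤ cosh(sb)` (the exponential lies below its chord on `[−b, b]`). [folklore] -/
theorem integral_exp_mul_le_cosh (μ : Measure X) [IsProbabilityMeasure μ] {V : X → ℝ} (hV : Measurable V) {b : ℝ} (hb : 0 < b)
    (hVb : ∀ x, |V x| ≤ b) (hV0 : ∫ x, V x ∂μ = 0) (s : ℝ) :
    ∫ x, Real.exp (s * V x) ∂μ ≤ Real.cosh (s * b) := by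
  -- chord of `exp` between `−sb` and `sb`
  have hchord : ∀ x, Real.exp (s * V x) ≤ ((b - V x) / (2 * b)) * Real.exp (-(s * b)) + ((V x + b) / (2 * b)) * Real.exp (s * b) := by
    intro x
    obtain ⟨h1, h2⟩ := abs_le.1 (hVb x)
    have ha : 0 ≤ (b - V x) / (2 * b) := div_nonneg (by linarith) (by linarith)
    have hb' : 0 ≤ (V x + b) / (2 * b) := div_nonneg (by linarith) (by linarith)
    have hab : (b - V x) / (2 * b) + (V x + b) / (2 * b) = 1 := by field_simp; ring
    have h := convexOn_exp.2 (Set.mem_univ (-(s * b))) (Set.mem_univ (s * b)) ha hb' hab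
    have e : ((b - V x) / (2 * b)) • (-(s * b)) + ((V x + b) / (2 * b)) • (s * b) = s * V x := by
      simp only [smul_eq_mul]; field_simp; ring
    rw [e] at h
    simpa only [smul_eq_mul] using h
  have iexp : Integrable (fun x => Real.exp (s * V x)) μ :=
    integrable_of_measurable_of_abs_le μ (Real.measurable_exp.comp (hV.const_mul s)) (B := Real.exp (|s| * b)) fun x => by
      rw [abs_of_pos (Real.exp_pos _)]
      refine Real.exp_le_exp.2 ?_
      calc s * V x ≤ |s * V x| := le_abs_self _
        _ = |s| * |V x| := abs_mul _ _
        _ ≤ |s| * b := mul_le_mul_of_nonneg_left (hVb x) (abs_nonneg _)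
  have iV : Integrable V μ := integrable_of_measurable_of_abs_le μ hV hVb
  have i1 : Integrable (fun x => ((b - V x) / (2 * b)) * Real.exp (-(s * b))) μ := ((integrable_const b).sub iV).div_const _ |>.mul_const _
  have i2 : Integrable (fun x => ((V x + b) / (2 * b)) * Real.exp (s * b)) μ := (iV.add (integrable_const b)).div_const _ |>.mul_const _
  calc ∫ x, Real.exp (s * V x) ∂μ ≤ ∫ x, (((b - V x) / (2 * b)) * Real.exp (-(s * b)) + ((V x + b) / (2 * b)) * Real.exp (s * b)) ∂μ :=
        integral_mono iexp (i1.add i2) hchord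
    _ = Real.cosh (s * b) := by
        rw [integral_add i1 i2, integral_mul_const, integral_mul_const, integral_div, integral_div, integral_sub (integrable_const b) iV,
          integral_add iV (integrable_const b), integral_const, probReal_univ, one_smul, hV0, Real.cosh_eq]
        field_simp
        ring

/-- ★ **Two-point reduction**: for `μ` a probability measure, `|V| ≤ b` (`b > 0`), `∫ V dμ = 0`, `0 ≤ s`, `0 ≤ r` and `m > r·e^{sb}`:
`∫ e^{sV}/(m − re^{sV}) dμ ≤ ½·(x₋/(m − rx₋) + x₊/(m − rx₊))`, `x± = e^{±sb}` — the symmetric two-point law is the worst case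
(Möbius chord + Hoeffding's lemma). [cite: LeonPerron2004, Theorem 1 (reduction to the two-state chain)] -/
theorem integral_moebius_exp_le_two_point (μ : Measure X) [IsProbabilityMeasure μ] {V : X → ℝ} (hV : Measurable V) {b : ℝ} (hb : 0 < b)
    (hVb : ∀ x, |V x| ≤ b) (hV0 : ∫ x, V x ∂μ = 0) {s r m : ℝ} (hs : 0 ≤ s) (hr : 0 ≤ r) (hm : r * Real.exp (s * b) < m) :
    ∫ x, Real.exp (s * V x) / (m - r * Real.exp (s * V x)) ∂μ ≤
      (1 / 2) * (Real.exp (-(s * b)) / (m - r * Real.exp (-(s * b))) + Real.exp (s * b) / (m - r * Real.exp (s * b))) := by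
  set xl : ℝ := Real.exp (-(s * b)) with hxl
  set xu : ℝ := Real.exp (s * b) with hxu
  have hsb : 0 < s * b ∨ s * b = 0 := by
    rcases (mul_nonneg hs hb.le).lt_or_eq with h | h
    · exact Or.inl h
    · exact Or.inr h.symm
  have hrange : ∀ x, xl ≤ Real.exp (s * V x) ∧ Real.exp (s * V x) ≤ xu := fun x => by
    obtain ⟨h1, h2⟩ := abs_le.1 (hVb x)
    refine ⟨Real.exp_le_exp.2 ?_, Real.exp_le_exp.2 (mul_le_mul_of_nonneg_left h2 hs)⟩
    have := mul_le_mul_of_nonneg_left h1 hs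
    linarith
  have hDu : 0 < m - r * xu := by rw [hxu]; linarith
  have hDpos : ∀ x, 0 < m - r * Real.exp (s * V x) := fun x => by nlinarith [(hrange x).2]
  have hlu' : xl ≤ xu := Real.exp_le_exp.2 (by nlinarith [mul_nonneg hs hb.le])
  have hDl : 0 < m - r * xl := by nlinarith
  rcases hsb with hsb | hsb
  · -- nondegenerate: `xl < xu`
    have hlu : xl < xu := Real.exp_lt_exp.2 (by linarith)
    have hne1 : m - r * xl ≠ 0 := hDl.ne'
    have hne2 : m - r * xu ≠ 0 := hDu.ne'
    have hne3 : xu - xl ≠ 0 := by linarith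
    set slope : ℝ := (xu / (m - r * xu) - xl / (m - r * xl)) / (xu - xl) with hslope
    have hslope0 : 0 ≤ slope := by
      rw [hslope]
      refine div_nonneg ?_ (by linarith)
      rw [div_sub_div _ _ hDu.ne' hDl.ne', le_div_iff₀ (mul_pos hDu hDl), zero_mul]
      have hm0 : 0 < m := by nlinarith [Real.exp_pos (s * b)]
      nlinarith [mul_pos hm0 (sub_pos.2 hlu)]
    have hpt : ∀ x, Real.exp (s * V x) / (m - r * Real.exp (s * V x)) ≤ xl / (m - r * xl) + slope * (Real.exp (s * V x) - xl) := by
      intro x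
      have h := moebius_chord_le hr (by rw [hxu]; exact hm) hlu (hrange x).1 (hrange x).2 (Real.exp_pos _).le
      rw [hslope]
      calc _ ≤ _ := h
        _ = xl / (m - r * xl) + (xu / (m - r * xu) - xl / (m - r * xl)) / (xu - xl) * (Real.exp (s * V x) - xl) := by ring
    have hexpm : Measurable fun x => Real.exp (s * V x) := Real.measurable_exp.comp (hV.const_mul s)
    have iL : Integrable (fun x => Real.exp (s * V x) / (m - r * Real.exp (s * V x))) μ :=
      integrable_of_measurable_of_abs_le μ (hexpm.div (measurable_const.sub (hexpm.const_mul r))) (B := xu / (m - r * xu)) fun x => by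
        rw [abs_of_nonneg (div_nonneg (Real.exp_pos _).le (hDpos x).le)]
        exact div_le_div₀ (Real.exp_pos _).le (hrange x).2 hDu (by nlinarith [(hrange x).2])
    have iexp : Integrable (fun x => Real.exp (s * V x)) μ :=
      integrable_of_measurable_of_abs_le μ hexpm (B := xu) fun x => by rw [abs_of_pos (Real.exp_pos _)]; exact (hrange x).2
    have iR : Integrable (fun x => xl / (m - r * xl) + slope * (Real.exp (s * V x) - xl)) μ :=
      (integrable_const _).add ((iexp.sub (integrable_const _)).const_mul _)
    have hcosh := integral_exp_mul_le_cosh μ hV hb hVb hV0 s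
    have hcosh' : ∫ x, Real.exp (s * V x) ∂μ ≤ (xl + xu) / 2 := by
      rw [Real.cosh_eq] at hcosh; rw [hxl, hxu]; linarith
    calc ∫ x, Real.exp (s * V x) / (m - r * Real.exp (s * V x)) ∂μ ≤ ∫ x, (xl / (m - r * xl) + slope * (Real.exp (s * V x) - xl)) ∂μ :=
          integral_mono iL iR hpt
      _ = xl / (m - r * xl) + slope * ((∫ x, Real.exp (s * V x) ∂μ) - xl) := by
          have i2 : Integrable (fun x => slope * (Real.exp (s * V x) - xl)) μ := (iexp.sub (integrable_const _)).const_mul _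
          rw [integral_add (integrable_const _) i2, integral_const_mul, integral_sub iexp (integrable_const _)]
          simp only [integral_const, probReal_univ, one_smul]
      _ ≤ xl / (m - r * xl) + slope * ((xl + xu) / 2 - xl) := by
          have := mul_le_mul_of_nonneg_left (sub_le_sub_right hcosh' xl) hslope0; linarith
      _ = (1 / 2) * (xl / (m - r * xl) + xu / (m - r * xu)) := by
          rw [hslope]; field_simp; ring
  · -- degenerate `s b = 0`: `V`-independent integrand
    have hsV : ∀ x, s * V x = 0 := fun x => by
      have h0 : s = 0 := by
        rcases mul_eq_zero.1 hsb with h | h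
        · exact h
        · exact absurd h hb.ne'
      rw [h0, zero_mul]
    have e0 : xl = 1 := by rw [hxl, hsb, neg_zero, Real.exp_zero]
    have e1 : xu = 1 := by rw [hxu, hsb, Real.exp_zero]
    simp_rw [hsV, Real.exp_zero]
    rw [integral_const, probReal_univ, one_smul, e0, e1]
    linarith

/-! ## §3. The root bound and the León–Perron form bound -/

omit [MeasurableSpace X] in
/-- ★ **The root bound.**  With `0 ≤ r < 1`, `κ = (1+r)/(1−r)`, `0 ≤ x` and `m = exp(κx²/2)`:  `r·eˣ < m` and the two-point secular value is
at most one, `½(1 − r)·(e^{−x}/(m − re^{−x}) + eˣ/(m − reˣ)) ≤ 1` — equivalently `m² − (1+r)cosh(x)·m + r ≥ 0`, from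
`e^{κy} + re^{−κy} ≥ (1+r)e^{y} ≥ (1+r)cosh x` (`y = x²/2`; two-point Jensen for `exp`, `cosh x ≤ e^{x²/2}`). [cite: LeonPerron2004, Theorem 1] -/
theorem two_point_secular_le_one {r x : ℝ} (hr0 : 0 ≤ r) (hr1 : r < 1) (hx : 0 ≤ x) :
    r * Real.exp x < Real.exp ((1 + r) / (1 - r) * x ^ 2 / 2) ∧
      (1 / 2) * (1 - r) * (Real.exp (-x) / (Real.exp ((1 + r) / (1 - r) * x ^ 2 / 2) - r * Real.exp (-x)) +
        Real.exp x / (Real.exp ((1 + r) / (1 - r) * x ^ 2 / 2) - r * Real.exp x)) ≤ 1 := by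
  set κ : ℝ := (1 + r) / (1 - r) with hκ
  have h1r : 0 < 1 - r := by linarith
  have hκ1 : 1 ≤ κ := by rw [hκ, le_div_iff₀ h1r]; linarith
  have hκid : κ * (1 - r) = 1 + r := by rw [hκ]; field_simp
  set m : ℝ := Real.exp (κ * x ^ 2 / 2) with hmdef
  have hm0 : 0 < m := Real.exp_pos _
  -- (i) `r eˣ < m`
  have hlt : r * Real.exp x < m := by
    have h1 : r ≤ Real.exp (r - 1) := by have := Real.add_one_le_exp (r - 1); linarith
    have h2 : x + (r - 1) < κ * x ^ 2 / 2 := by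
      have key : κ * (κ * x ^ 2 / 2 - x - (r - 1)) = ((κ * x - 1) ^ 2 + 1 + 2 * r) / 2 := by linear_combination hκid
      have hpos : 0 < κ * (κ * x ^ 2 / 2 - x - (r - 1)) := by rw [key]; positivity
      have hκ0 : 0 < κ := by linarith
      nlinarith
    calc r * Real.exp x ≤ Real.exp (r - 1) * Real.exp x := mul_le_mul_of_nonneg_right h1 (Real.exp_pos _).le
      _ = Real.exp (x + (r - 1)) := by rw [← Real.exp_add]; ring_nf
      _ < m := Real.exp_lt_exp.2 h2
  refine ⟨hlt, ?_⟩
  -- (ii) `q(m) ≥ 0`: `(1+r)·cosh x · m ≤ m² + r`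
  have hxx : Real.exp x * Real.exp (-x) = 1 := by rw [← Real.exp_add, add_neg_cancel, Real.exp_zero]
  have hq : (1 + r) * ((Real.exp x + Real.exp (-x)) / 2) * m ≤ m ^ 2 + r := by
    -- two-point Jensen: `(1+r) e^{y} ≤ e^{κy} + r e^{−κy}`, `y = x²/2`
    set y : ℝ := x ^ 2 / 2 with hy
    have ha : 0 ≤ 1 / (1 + r) := by positivity
    have hb : 0 ≤ r / (1 + r) := by positivity
    have hab : 1 / (1 + r) + r / (1 + r) = 1 := by field_simp
    have hJ := convexOn_exp.2 (Set.mem_univ (κ * y)) (Set.mem_univ (-(κ * y))) ha hb hab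
    have e : (1 / (1 + r)) • (κ * y) + (r / (1 + r)) • (-(κ * y)) = y := by
      simp only [smul_eq_mul]
      rw [hκ]; field_simp; ring
    rw [e] at hJ
    simp only [smul_eq_mul] at hJ
    -- `cosh x ≤ e^{x²/2}`
    have hcosh : (Real.exp x + Real.exp (-x)) / 2 ≤ Real.exp y := by
      have h := Real.cosh_le_exp_half_sq x
      rw [Real.cosh_eq] at h; rw [hy]; exact h
    have hm_eq : m = Real.exp (κ * y) := by rw [hmdef, hy]; ring_nf
    have hminv : r = r * Real.exp (-(κ * y)) * m := by
      rw [hm_eq, mul_assoc, ← Real.exp_add, neg_add_cancel, Real.exp_zero, mul_one]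
    have h1 : (1 + r) * Real.exp y ≤ Real.exp (κ * y) + r * Real.exp (-(κ * y)) := by
      have := mul_le_mul_of_nonneg_left hJ (by linarith : (0 : ℝ) ≤ 1 + r)
      have e2 : (1 + r) * (1 / (1 + r) * Real.exp (κ * y) + r / (1 + r) * Real.exp (-(κ * y))) =
          Real.exp (κ * y) + r * Real.exp (-(κ * y)) := by field_simp
      linarith [e2 ▸ this]
    calc (1 + r) * ((Real.exp x + Real.exp (-x)) / 2) * m ≤ (1 + r) * Real.exp y * m := by
          have := mul_le_mul_of_nonneg_left hcosh (by linarith : (0 : ℝ) ≤ 1 + r)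
          exact mul_le_mul_of_nonneg_right this hm0.le
      _ ≤ (Real.exp (κ * y) + r * Real.exp (-(κ * y))) * m := mul_le_mul_of_nonneg_right h1 hm0.le
      _ = m ^ 2 + r := by rw [add_mul, ← hminv, ← hm_eq, sq]
  -- the two-point secular value
  have hDu : 0 < m - r * Real.exp x := by linarith
  have hDl : 0 < m - r * Real.exp (-x) := by
    have : Real.exp (-x) ≤ Real.exp x := Real.exp_le_exp.2 (by linarith)
    nlinarith
  have hfrac : (1 / 2) * (1 - r) * (Real.exp (-x) / (m - r * Real.exp (-x)) + Real.exp x / (m - r * Real.exp x)) =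
      ((1 / 2) * (1 - r) * (Real.exp (-x) * (m - r * Real.exp x) + (m - r * Real.exp (-x)) * Real.exp x)) /
        ((m - r * Real.exp (-x)) * (m - r * Real.exp x)) := by
    field_simp
  have hnum : (m - r * Real.exp (-x)) * (m - r * Real.exp x) -
      (1 / 2) * (1 - r) * (Real.exp (-x) * (m - r * Real.exp x) + (m - r * Real.exp (-x)) * Real.exp x) =
      (m ^ 2 + r) - (1 + r) * ((Real.exp x + Real.exp (-x)) / 2) * m := by
    linear_combination r * hxx
  rw [hfrac, div_le_one (mul_pos hDl hDu)]
  linarith [hnum, hq]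

/-- ★★★ **THE LEÓN–PERRON / FAN–JIANG–SUN FORM BOUND.**  On a probability space `(X, μ)` let `V` be measurable with `|V| ≤ b` (`b > 0`) and
`∫ V dμ = 0`; let `0 ≤ s` and `0 ≤ r < 1`.  Then for EVERY bounded measurable `g`

  `r ∫ e^{sV} g² dμ + (1 − r)(∫ e^{sV/2} g dμ)² ≤ exp( ((1+r)/(1−r)) · (sb)²/2 ) · ∫ g² dμ`.

With `r = e^{−λh}` the left side is the quadratic form of the Feynman–Kac sandwich of the `h`-skeleton chain tilted by `sV`, so the
`N`-step exponential moment grows at most like `exp(N·(1+r)(sb)²/(2(1−r)))`: Hoeffding's lemma for reversible chains with the variance proxy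
`(1+r)/(1−r)·b²`, optimal for two-state chains. [cite: LeonPerron2004, Theorem 1] -/
theorem hoeffding_form_bound (μ : Measure X) [IsProbabilityMeasure μ] {V : X → ℝ} (hV : Measurable V) {b : ℝ} (hb : 0 < b)
    (hVb : ∀ x, |V x| ≤ b) (hV0 : ∫ x, V x ∂μ = 0) {s r : ℝ} (hs : 0 ≤ s) (hr0 : 0 ≤ r) (hr1 : r < 1)
    {g : X → ℝ} (hg : Measurable g) {C : ℝ} (hgC : ∀ x, |g x| ≤ C) :
    r * ∫ x, Real.exp (s * V x) * g x ^ 2 ∂μ + (1 - r) * (∫ x, Real.exp (s * V x / 2) * g x ∂μ) ^ 2 ≤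
      Real.exp ((1 + r) / (1 - r) * (s * b) ^ 2 / 2) * ∫ x, g x ^ 2 ∂μ := by
  set m : ℝ := Real.exp ((1 + r) / (1 - r) * (s * b) ^ 2 / 2) with hmdef
  obtain ⟨hlt, hsec2⟩ := two_point_secular_le_one hr0 hr1 (mul_nonneg hs hb.le)
  -- the weight `w = e^{sV/2}`, `w² = e^{sV}`, `|w| ≤ e^{sb/2}`
  have hwm : Measurable fun x => Real.exp (s * V x / 2) := Real.measurable_exp.comp ((hV.const_mul s).div_const 2)
  have hww : ∀ x, Real.exp (s * V x / 2) ^ 2 = Real.exp (s * V x) := fun x => by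
    rw [sq, ← Real.exp_add]; congr 1; ring
  have hwW : ∀ x, |Real.exp (s * V x / 2)| ≤ Real.exp (s * b / 2) := fun x => by
    rw [abs_of_pos (Real.exp_pos _)]
    refine Real.exp_le_exp.2 ?_
    have := mul_le_mul_of_nonneg_left ((le_abs_self _).trans (hVb x)) hs
    linarith
  have hW2 : Real.exp (s * b / 2) ^ 2 = Real.exp (s * b) := by rw [sq, ← Real.exp_add]; congr 1; ring
  have hm : r * Real.exp (s * b / 2) ^ 2 < m := by rw [hW2]; exact hlt
  -- the secular condition via the two-point reduction
  have hsec : (1 - r) * ∫ x, Real.exp (s * V x / 2) ^ 2 / (m - r * Real.exp (s * V x / 2) ^ 2) ∂μ ≤ 1 := by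
    simp_rw [hww]
    have h2 := integral_moebius_exp_le_two_point μ hV hb hVb hV0 hs hr0 hlt
    have h3 := mul_le_mul_of_nonneg_left h2 (by linarith : (0 : ℝ) ≤ 1 - r)
    refine h3.trans ?_
    have e : (1 - r) * (1 / 2 * (Real.exp (-(s * b)) / (m - r * Real.exp (-(s * b))) + Real.exp (s * b) / (m - r * Real.exp (s * b)))) =
        1 / 2 * (1 - r) * (Real.exp (-(s * b)) / (m - r * Real.exp (-(s * b))) + Real.exp (s * b) / (m - r * Real.exp (s * b))) := by ring
    rw [e]; exact hsec2
  have h := form_le_of_secular μ hwm hwW hr0 hm hsec hg hgC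
  simp_rw [hww] at h
  exact h

end Summit.QuantumFields.YangMills.Theorems.ColdStartUniversality.FeynmanKac

end
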